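import Mathlib
import Literature.NumberTheory.Sieve.PolymathMkEpsJ
import HarnessLib

/-!
# DHL[42,2] certificate — §6.2 toolkit: tame functions; coordinates and integrals on `ℝ × ℝⁿ`

§0 `Tame s f` (measurable, bounded, vanishing off `s`; ⇒ integrable when `|s| < ∞`) and its closure
properties; §1 coordinates: continuity of `Fin.cons`/`Fin.insertNth` pairings,
`insertNth_eq_cons_comp_cycleRange`, the simplex `B·R_{n+1}` under `cons` and permutations,
transport of integrals along `t ↦ (t_m, t^{(m)})` (`integral_eq_integral_insertNth`, volume
preserving) and Fubini on `ℝ × ℝⁿ` (`integral_prod_eq_integral_integral`). General `n`; nothing here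
refers to the §7 data.

Origin: `Dhl42/CertificateInequality.lean` of the DHL[42,2] certificate package (pub-dhl42 bundle,
archive blob `18cce9e3`; sha256[:16] of the file `ba7c9b2361ca6afe`; paper snapshot =
`paper/main.tex` v1), lines :62–:267; statements and proofs unchanged except: namespace `TpY4Dhl42`
→ `Summit.Parity.GeneralizedHardyLittlewood.Theorems.Dhl42`, the package's `simplexSet n B` replaced
by the tree's definitionally equal `Literature.NumberTheory.Sieve.scaledSimplex n B` (also inside
declaration names), docstrings added where missing, `#print axioms` lines dropped. Package-internal
references in the verbatim docstrings (`Dhl42/….lean`, `Assumed.…`, `row 9…`, `gen n`,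
`inputs/COMPARE.md`) refer to that package (paper Appendix B).

Declarations (35): `Tame`, `integrable`, `integrableOn`, `mono`, `mul_bdd`, `bdd_mul`, `bdd'`,
`mul`, `indicator`, `abs`, `sq`, `const_mul`, `congr'`, `tame_indicator_one`, `tame_univ_of_bdd`,
`abs_indicator_one_le`, `indicator_one_congr`, `continuous_consPair`, `continuous_consPair'`,
`continuous_cons_left`, `continuous_insertNthPair`, `insertNth_eq_cons_comp_cycleRange`, `sum_cons`,
`mem_scaledSimplex_cons_iff`, `mem_Icc_of_cons_mem_scaledSimplex`,
`mem_Icc_of_cons_mem_scaledSimplex'`, `tail_mem_scaledSimplex_of_cons_mem`,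
`comp_perm_mem_scaledSimplex_iff`, `integral_eq_integral_insertNth`, `integrable_insertNth`,
`integral_eq_integral_cons`, `integrable_cons`, `volume_prod_eq`,
`integral_prod_eq_integral_integral`, `volume_prod_ne_top`.
-/

open MeasureTheory Set Filter
open Literature.NumberTheory.Sieve (scaledSimplex)

namespace Summit.Parity.GeneralizedHardyLittlewood.Theorems.Dhl42

noncomputable section

/-! ### §0. Toolkit: bounded measurable functions with support of finite measure -/

/-- `Tame s f`: `f` is measurable, bounded, and vanishes outside `s`. -/
structure Tame {α : Type*} [MeasurableSpace α] (s : Set α) (f : α → ℝ) : Prop where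
  measurable : Measurable f
  bdd : ∃ C, 0 ≤ C ∧ ∀ x, |f x| ≤ C
  eq_zero : ∀ x, x ∉ s → f x = 0

namespace Tame

variable {α : Type*}

/-- A tame function on a set of finite measure is integrable (bounded, measurable, supported in
`s`). -/
theorem integrable [MeasureSpace α] {s : Set α} {f : α → ℝ} (h : Tame s f) (hs : volume s ≠ ⊤) :
    Integrable f := by
  obtain ⟨C, -, hC⟩ := h.bdd
  have hsupp : Function.support f ⊆ s := Function.support_subset_iff'.2 h.eq_zero
  rw [← integrableOn_iff_integrable_of_support_subset hsupp]
  exact Measure.integrableOn_of_bounded hs h.measurable.aestronglyMeasurable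
    (Eventually.of_forall fun x => by simpa [Real.norm_eq_abs] using hC x)

/-- A tame function on a set of finite measure is integrable on every set. -/
theorem integrableOn [MeasureSpace α] {s : Set α} {f : α → ℝ} (h : Tame s f) (hs : volume s ≠ ⊤)
    (t : Set α) : IntegrableOn f t := (h.integrable hs).integrableOn

/-- Tameness persists when the ambient set `s` is enlarged. -/
theorem mono [MeasurableSpace α] {s s' : Set α} {f : α → ℝ} (h : Tame s f) (hss' : s ⊆ s') :
    Tame s' f :=
  ⟨h.measurable, h.bdd, fun x hx => h.eq_zero x fun hx' => hx (hss' hx')⟩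

/-- A tame function times a bounded measurable function is tame (on the same set). -/
theorem mul_bdd [MeasurableSpace α] {s : Set α} {f g : α → ℝ} (h : Tame s f) (hg : Measurable g)
    (hgb : ∃ C, ∀ x, |g x| ≤ C) : Tame s fun x => f x * g x := by
  obtain ⟨C, hC0, hC⟩ := h.bdd
  obtain ⟨D, hD⟩ := hgb
  refine ⟨h.measurable.mul hg, ⟨C * max D 0, mul_nonneg hC0 (le_max_right _ _), fun x => ?_⟩,
    fun x hx => by simp [h.eq_zero x hx]⟩
  rw [abs_mul]
  exact mul_le_mul (hC x) (le_trans (hD x) (le_max_left _ _)) (abs_nonneg _) hC0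

/-- A bounded measurable function times a tame function is tame (on the same set). -/
theorem bdd_mul [MeasurableSpace α] {s : Set α} {f g : α → ℝ} (h : Tame s f) (hg : Measurable g)
    (hgb : ∃ C, ∀ x, |g x| ≤ C) : Tame s fun x => g x * f x := by
  have := h.mul_bdd hg hgb
  refine ⟨hg.mul h.measurable, ?_, fun x hx => by simp [h.eq_zero x hx]⟩
  obtain ⟨C, hC0, hC⟩ := this.bdd
  exact ⟨C, hC0, fun x => by rw [mul_comm]; exact hC x⟩

/-- A tame function is bounded (the bound without its sign condition). -/
theorem bdd' [MeasurableSpace α] {s : Set α} {f : α → ℝ} (h : Tame s f) : ∃ C, ∀ x, |f x| ≤ C := by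
  obtain ⟨C, -, hC⟩ := h.bdd
  exact ⟨C, hC⟩

/-- The product of two tame functions is tame on the set of the first factor. -/
theorem mul [MeasurableSpace α] {s s' : Set α} {f g : α → ℝ} (h : Tame s f) (hg : Tame s' g) :
    Tame s fun x => f x * g x :=
  h.mul_bdd hg.measurable hg.bdd'

/-- A tame function cut off by a measurable set is tame. -/
theorem indicator [MeasurableSpace α] {s : Set α} {f : α → ℝ} (h : Tame s f) {t : Set α}
    (ht : MeasurableSet t) : Tame s (t.indicator f) := by
  obtain ⟨C, hC0, hC⟩ := h.bdd
  refine ⟨h.measurable.indicator ht, ⟨C, hC0, fun x => ?_⟩, fun x hx => by simp [h.eq_zero x hx]⟩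
  by_cases hx : x ∈ t
  · rw [indicator_of_mem hx]; exact hC x
  · rw [indicator_of_notMem hx, abs_zero]; exact hC0

/-- The absolute value of a tame function is tame. -/
theorem abs [MeasurableSpace α] {s : Set α} {f : α → ℝ} (h : Tame s f) : Tame s fun x => |f x| := by
  obtain ⟨C, hC0, hC⟩ := h.bdd
  exact ⟨h.measurable.abs, ⟨C, hC0, fun x => by rw [abs_abs]; exact hC x⟩,
    fun x hx => by simp [h.eq_zero x hx]⟩

/-- The square of a tame function is tame. -/
theorem sq [MeasurableSpace α] {s : Set α} {f : α → ℝ} (h : Tame s f) : Tame s fun x => f x ^ 2 := by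
  have := h.mul h
  simpa [pow_two] using this

/-- A constant multiple of a tame function is tame. -/
theorem const_mul [MeasurableSpace α] {s : Set α} {f : α → ℝ} (h : Tame s f) (c : ℝ) :
    Tame s fun x => c * f x :=
  h.bdd_mul measurable_const ⟨|c|, fun _ => le_rfl⟩

/-- Transport of tameness along an equality of functions. -/
theorem congr' [MeasurableSpace α] {s : Set α} {f g : α → ℝ} (h : Tame s f) (hfg : f = g) :
    Tame s g := hfg ▸ h

end Tame

/-- The indicator of a measurable subset is tame (bounded by `1`). -/
theorem tame_indicator_one {α : Type*} [MeasurableSpace α] {s t : Set α} (ht : MeasurableSet t)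
    (hts : t ⊆ s) : Tame s (t.indicator (1 : α → ℝ)) := by
  refine ⟨measurable_one.indicator ht, ⟨1, zero_le_one, fun x => ?_⟩,
    fun x hx => indicator_of_notMem (fun hx' => hx (hts hx')) _⟩
  by_cases hx : x ∈ t
  · simp [hx]
  · simp [hx]

/-- A bounded measurable function is tame on `univ`. -/
theorem tame_univ_of_bdd {α : Type*} [MeasurableSpace α] {f : α → ℝ} (hf : Measurable f)
    (hb : ∃ C, ∀ x, |f x| ≤ C) : Tame univ f := by
  obtain ⟨C, hC⟩ := hb
  exact ⟨hf, ⟨max C 0, le_max_right _ _, fun x => le_trans (hC x) (le_max_left _ _)⟩,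
    fun x hx => absurd (mem_univ x) hx⟩

/-- `|1_t(x)| ≤ 1` for the real-valued indicator of a set. -/
theorem abs_indicator_one_le {α : Type*} (t : Set α) (x : α) : |t.indicator (1 : α → ℝ) x| ≤ 1 := by
  by_cases hx : x ∈ t
  · simp [hx]
  · simp [hx]

/-- Indicators of "the same event" agree. -/
theorem indicator_one_congr {α β : Type*} {s : Set α} {t : Set β} {x : α} {y : β}
    (h : x ∈ s ↔ y ∈ t) : s.indicator (1 : α → ℝ) x = t.indicator (1 : β → ℝ) y := by
  by_cases hx : x ∈ s
  · rw [indicator_of_mem hx, indicator_of_mem (h.1 hx)]; rfl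
  · rw [indicator_of_notMem hx, indicator_of_notMem (fun hy => hx (h.2 hy))]

/-! ### §1. Coordinates: `cons`, `insertNth`, symmetry, and the simplex -/

section Coordinates

variable {n : ℕ}

/-- `(s, t') ↦ (s, t'_1, …, t'_n)` (`Fin.cons` on `ℝ × ℝⁿ`) is continuous. -/
theorem continuous_consPair :
    Continuous fun p : ℝ × (Fin n → ℝ) => (Fin.cons p.1 p.2 : Fin (n + 1) → ℝ) :=
  Continuous.finCons continuous_fst continuous_snd

/-- `(t', s) ↦ (s, t'_1, …, t'_n)` (`Fin.cons` on `ℝⁿ × ℝ`) is continuous. -/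
theorem continuous_consPair' :
    Continuous fun p : (Fin n → ℝ) × ℝ => (Fin.cons p.2 p.1 : Fin (n + 1) → ℝ) :=
  Continuous.finCons continuous_snd continuous_fst

/-- For fixed `t'`, `s ↦ (s, t')` is continuous. -/
theorem continuous_cons_left (t' : Fin n → ℝ) :
    Continuous fun s : ℝ => (Fin.cons s t' : Fin (n + 1) → ℝ) :=
  Continuous.finCons continuous_id continuous_const

/-- `(s, t') ↦ Fin.insertNth m s t'` (inserting the coordinate `s` at place `m`) is continuous. -/
theorem continuous_insertNthPair (m : Fin (n + 1)) :
    Continuous fun p : ℝ × (Fin n → ℝ) => (Fin.insertNth m p.1 p.2 : Fin (n + 1) → ℝ) :=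
  Continuous.finInsertNth m continuous_fst continuous_snd

/-- Inserting a coordinate at place `m` is `cons` followed by the cyclic permutation `(0 1 … m)`. -/
theorem insertNth_eq_cons_comp_cycleRange (m : Fin (n + 1)) (s : ℝ) (t' : Fin n → ℝ) :
    (Fin.insertNth m s t' : Fin (n + 1) → ℝ) = (Fin.cons s t' : Fin (n + 1) → ℝ) ∘ ⇑(Fin.cycleRange m) := by
  funext j
  rcases Fin.eq_self_or_eq_succAbove m j with rfl | ⟨i, rfl⟩
  · simp [Fin.insertNth_apply_same]
  · simp [Fin.insertNth_apply_succAbove]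

/-- `Σ_j (s, t')_j = s + Σ_j t'_j`. -/
theorem sum_cons (s : ℝ) (t' : Fin n → ℝ) :
    ∑ j, (Fin.cons s t' : Fin (n + 1) → ℝ) j = s + ∑ j, t' j := by
  simp [Fin.sum_univ_succ]

/-- `(s, t') ∈ B·R_{n+1}` iff `0 ≤ s`, `t' ∈ [0,∞)^n` and `s + Σ t' ≤ B`. -/
theorem mem_scaledSimplex_cons_iff (s : ℝ) (t' : Fin n → ℝ) (B : ℝ) :
    (Fin.cons s t' : Fin (n + 1) → ℝ) ∈ scaledSimplex (n + 1) B ↔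
      0 ≤ s ∧ (∀ j, 0 ≤ t' j) ∧ s + ∑ j, t' j ≤ B := by
  simp only [scaledSimplex, mem_setOf_eq, Fin.forall_fin_succ, Fin.cons_zero, Fin.cons_succ, sum_cons]
  tauto

/-- If `(s, t') ∈ B·R_{n+1}` then `s ∈ [0, B − Σ t']`. -/
theorem mem_Icc_of_cons_mem_scaledSimplex {s : ℝ} {t' : Fin n → ℝ} {B : ℝ}
    (h : (Fin.cons s t' : Fin (n + 1) → ℝ) ∈ scaledSimplex (n + 1) B) :
    s ∈ Icc 0 (B - ∑ j, t' j) := by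
  rw [mem_scaledSimplex_cons_iff] at h
  exact ⟨h.1, by linarith [h.2.2]⟩

/-- If `(s, t') ∈ B·R_{n+1}` then `s ∈ [0, B]`. -/
theorem mem_Icc_of_cons_mem_scaledSimplex' {s : ℝ} {t' : Fin n → ℝ} {B : ℝ}
    (h : (Fin.cons s t' : Fin (n + 1) → ℝ) ∈ scaledSimplex (n + 1) B) : s ∈ Icc 0 B := by
  rw [mem_scaledSimplex_cons_iff] at h
  have : 0 ≤ ∑ j, t' j := Finset.sum_nonneg fun j _ => h.2.1 j
  exact ⟨h.1, by linarith [h.2.2]⟩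

/-- If `(s, t') ∈ B·R_{n+1}` then `t' ∈ B·R_n`. -/
theorem tail_mem_scaledSimplex_of_cons_mem {s : ℝ} {t' : Fin n → ℝ} {B : ℝ}
    (h : (Fin.cons s t' : Fin (n + 1) → ℝ) ∈ scaledSimplex (n + 1) B) : t' ∈ scaledSimplex n B := by
  rw [mem_scaledSimplex_cons_iff] at h
  exact ⟨h.2.1, by linarith [h.1, h.2.2]⟩

/-- `B·R_k` is invariant under permutations of the coordinates. -/
theorem comp_perm_mem_scaledSimplex_iff {k : ℕ} (σ : Equiv.Perm (Fin k)) (t : Fin k → ℝ) (B : ℝ) :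
    t ∘ ⇑σ ∈ scaledSimplex k B ↔ t ∈ scaledSimplex k B := by
  simp only [scaledSimplex, mem_setOf_eq, Function.comp_apply]
  rw [Equiv.sum_comp σ t]
  exact and_congr ⟨fun h j => by simpa using h (σ.symm j), fun h j => h (σ j)⟩ Iff.rfl

/-! Transport of integrals along `t ↦ (t_m, t^{(m)})` (volume preserving) and Fubini. -/

/-- Transport of the integral over `ℝ^{n+1}` along `(s, t') ↦ Fin.insertNth m s t'` (a
volume-preserving equivalence, `volume_preserving_piFinSuccAbove`). -/
theorem integral_eq_integral_insertNth (m : Fin (n + 1)) (φ : (Fin (n + 1) → ℝ) → ℝ) :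
    ∫ t, φ t = ∫ p : ℝ × (Fin n → ℝ), φ (Fin.insertNth m p.1 p.2) := by
  rw [← ((volume_preserving_piFinSuccAbove (fun _ : Fin (n + 1) => ℝ) m).symm).integral_comp'
    (g := φ)]
  rfl

/-- Integrability is transported along `(s, t') ↦ Fin.insertNth m s t'`. -/
theorem integrable_insertNth (m : Fin (n + 1)) {φ : (Fin (n + 1) → ℝ) → ℝ} (hφ : Integrable φ) :
    Integrable fun p : ℝ × (Fin n → ℝ) => φ (Fin.insertNth m p.1 p.2) :=
  (((volume_preserving_piFinSuccAbove (fun _ : Fin (n + 1) => ℝ) m).symm).integrable_comp_emb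
    (MeasurableEquiv.measurableEmbedding _)).2 hφ

/-- Transport of the integral over `ℝ^{n+1}` along `(s, t') ↦ (s, t')` (`Fin.cons` = insertion at
place `0`). -/
theorem integral_eq_integral_cons (φ : (Fin (n + 1) → ℝ) → ℝ) :
    ∫ t, φ t = ∫ p : ℝ × (Fin n → ℝ), φ (Fin.cons p.1 p.2) := by
  rw [integral_eq_integral_insertNth 0]
  simp only [Fin.insertNth_zero']

/-- Integrability is transported along `(s, t') ↦ (s, t')` (`Fin.cons`). -/
theorem integrable_cons {φ : (Fin (n + 1) → ℝ) → ℝ} (hφ : Integrable φ) :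
    Integrable fun p : ℝ × (Fin n → ℝ) => φ (Fin.cons p.1 p.2) := by
  simpa only [Fin.insertNth_zero'] using integrable_insertNth 0 hφ

/-- The volume on `ℝ × ℝⁿ` is the product of the volumes (definitional). -/
theorem volume_prod_eq :
    (volume : Measure (ℝ × (Fin n → ℝ))) = (volume : Measure ℝ).prod volume := rfl

/-- Fubini on `ℝ × ℝⁿ`, integrating the real coordinate inside. -/
theorem integral_prod_eq_integral_integral (Φ : ℝ × (Fin n → ℝ) → ℝ) (hΦ : Integrable Φ) :
    ∫ p, Φ p = ∫ t' : Fin n → ℝ, ∫ s : ℝ, Φ (s, t') := by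
  rw [volume_prod_eq] at hΦ ⊢
  exact integral_prod_symm Φ hΦ

/-- The product of two sets of finite measure has finite measure in `ℝ × ℝⁿ`. -/
theorem volume_prod_ne_top {A : Set ℝ} {A' : Set (Fin n → ℝ)} (hA : volume A ≠ ⊤)
    (hA' : volume A' ≠ ⊤) : volume (A ×ˢ A') ≠ ⊤ := by
  rw [volume_prod_eq, Measure.prod_prod]
  exact (ENNReal.mul_lt_top hA.lt_top hA'.lt_top).ne

end Coordinates

end

end Summit.Parity.GeneralizedHardyLittlewood.Theorems.Dhl42
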